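import Mathlib.Topology.Homotopy.Equiv
import Mathlib.Analysis.Normed.Module.Basic
import Mathlib.Topology.MetricSpace.ProperSpace
import HarnessLib

/-!
# The complement of an embedded open ball is a deformation retract of the punctured space

Topic `Literature/AlgebraicTopology/Homotopy`. Elementary homotopy theory, absent from Mathlib,
vendored for the decomposition of the named fact
`Literature.Topology.FourManifolds.HomotopySphere.contractibleSpace_compl_image_ball`
(`Literature/Topology/FourManifolds/HomotopySpheresSum.lean`; Kosinski, *Differential Manifolds*
(1993), VI §1: a homotopy sphere with the interior of a disc deleted is contractible), whose
classical proof computes the fundamental group and the homology of `Σ ∖ i (B)` through those of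
the punctured manifold `Σ ∖ {i 0}`, of which it is a deformation retract.

**Theorem** (`Literature.AlgebraicTopology.Homotopy.BallComplement.homotopyEquiv`). Let `E` be a proper real normed space (e.g.
`ℝⁿ`), `X` a Hausdorff space and `i : E → X` an open embedding (a "disc"). Then the closed
subspace `X ∖ i (B)`, `B = {‖v‖ < 1}` the open unit ball, is a strong deformation retract of the
punctured space `X ∖ {i 0}`; in particular the inclusion `X ∖ i (B) → X ∖ {i 0}` is a homotopy
equivalence (Hatcher, *Algebraic Topology* (2002), Ch. 0, p. 2 (deformation retractions) and
proof of Thm. 2.26: "`ℝᵐ - {x}` deformation retracts onto a sphere `Sᵐ⁻¹`", here transported into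
`X` by `i` and extended by the identity outside the disc).

**Proof.** The radial deformation `ρ_t (i v) = i (((1 - t) + t/‖v‖) v)` for `0 < ‖v‖ ≤ 1`,
`ρ_t = id` off `i (closed unit ball)`; the two formulas agree on `i (unit sphere)`, both pieces
are closed in `X ∖ {i 0}` (`i (closed ball)` is compact, `i (B)` is open), so `ρ` is jointly
continuous by pasting; `ρ_0 = id`, `ρ_t` fixes `X ∖ i (B)` pointwise, and `ρ_1` retracts
`X ∖ {i 0}` onto `X ∖ i (B)`.

## Main statements

* `Literature.AlgebraicTopology.Homotopy.BallComplement.deform`: the deformation `ρ : [0,1] × (X ∖ {i 0}) → X ∖ {i 0}`, jointly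
  continuous (`continuous_deform`), with `ρ_0 = id` (`deform_zero`), `ρ_t = id` on `X ∖ i (B)`
  (`deform_incl`, `deformFun_of_not_mem`), `ρ_1 ∈ X ∖ i (B)` (`deformFun_one_not_mem`).
* `Literature.AlgebraicTopology.Homotopy.BallComplement.retr`: the retraction `X ∖ {i 0} → X ∖ i (B)`, `retr ∘ incl = id`
  (`retr_comp_incl`); `deformHomotopy`: `id ≃ incl ∘ retr` rel `X ∖ i (B)`.
* `Literature.BallComplement.homotopyEquiv : ↥(i '' ball 0 1)ᶜ ≃ₕ ↥{i 0}ᶜ` (the inclusion, with homotopy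
  inverse `retr`).

## References

* A. Hatcher, *Algebraic Topology*, CUP (2002), Ch. 0 p. 2 (deformation retractions), proof of
  Thm. 2.26 (`ℝᵐ - {x}` deformation retracts onto `Sᵐ⁻¹`). [HatcherAT2002]
* A. Kosinski, *Differential Manifolds*, Academic Press (1993), Ch. VI §1. [Kosinski1993]

## Design notes

* `i` is any open embedding of a proper real normed space (properness makes `i (closed ball)`
  compact, hence closed in the Hausdorff `X`); the application is `E = ℝⁿ`, `i` a smooth disc.
* All maps are plain functions defined by case distinction; continuity by pasting two closed
  pieces (`ContinuousOn.union_of_isClosed`). No named facts; nothing uses `sorry`.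
-/

noncomputable section

open Set Function Metric Topology
open scoped unitInterval Topology ContinuousMap

namespace Literature.AlgebraicTopology.Homotopy

namespace BallComplement

universe u v

variable {E : Type u} [NormedAddCommGroup E] [NormedSpace ℝ E] {X : Type v} [TopologicalSpace X]
  {i : E → X}

attribute [local instance] Classical.propDecidable

/-! ### The radial push in the model space -/

/-- The radial push `((1 - t) + t / ‖v‖) • v`: the identity at `t = 0`, the radial projection to
the unit sphere at `t = 1` (for `v ≠ 0`). [folklore] -/
def radialPush (t : ℝ) (v : E) : E := ((1 - t) + t * ‖v‖⁻¹) • v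

/-- `radialPush 0 = id`. [folklore] -/
@[simp] theorem radialPush_zero (v : E) : radialPush 0 v = v := by simp [radialPush]

/-- At `t = 1` the radial push is the radial projection `v / ‖v‖`. [folklore] -/
theorem radialPush_one (v : E) : radialPush 1 v = ‖v‖⁻¹ • v := by simp [radialPush]

/-- On the unit sphere the radial push is the identity. [folklore] -/
theorem radialPush_of_norm_eq_one (t : ℝ) {v : E} (hv : ‖v‖ = 1) : radialPush t v = v := by
  simp [radialPush, hv]

omit [NormedSpace ℝ E] in
/-- The coefficient of the radial push is `≥ 1` on the closed unit ball (`0 ≤ t`). [folklore] -/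
theorem one_le_coeff {t : ℝ} (ht₀ : 0 ≤ t) {v : E} (hv₀ : v ≠ 0) (hv₁ : ‖v‖ ≤ 1) :
    1 ≤ (1 - t) + t * ‖v‖⁻¹ := by
  have hn : 0 < ‖v‖ := norm_pos_iff.2 hv₀
  have h1 : 1 ≤ ‖v‖⁻¹ := (one_le_inv₀ hn).2 hv₁
  nlinarith

/-- The radial push of a nonzero vector of the closed unit ball is nonzero (`0 ≤ t`).
[folklore] -/
theorem radialPush_ne_zero {t : ℝ} (ht₀ : 0 ≤ t) {v : E} (hv₀ : v ≠ 0) (hv₁ : ‖v‖ ≤ 1) :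
    radialPush t v ≠ 0 := by
  rw [radialPush, smul_ne_zero_iff]
  exact ⟨by linarith [one_le_coeff ht₀ hv₀ hv₁], hv₀⟩

/-- The radial push keeps the closed unit ball (`0 ≤ t ≤ 1`). [folklore] -/
theorem norm_radialPush_le_one {t : ℝ} (ht₀ : 0 ≤ t) (ht₁ : t ≤ 1) {v : E} (hv₀ : v ≠ 0)
    (hv₁ : ‖v‖ ≤ 1) : ‖radialPush t v‖ ≤ 1 := by
  have hn : 0 < ‖v‖ := norm_pos_iff.2 hv₀
  have hc := one_le_coeff ht₀ hv₀ hv₁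
  rw [radialPush, norm_smul, Real.norm_eq_abs, abs_of_pos (by linarith), add_mul,
    inv_mul_cancel_right₀ hn.ne']
  nlinarith

/-- At `t = 1` the radial push of a nonzero vector is a unit vector. [folklore] -/
theorem norm_radialPush_one {v : E} (hv₀ : v ≠ 0) : ‖radialPush 1 v‖ = 1 := by
  have hn : 0 < ‖v‖ := norm_pos_iff.2 hv₀
  rw [radialPush_one, norm_smul, norm_inv, norm_norm, inv_mul_cancel₀ hn.ne']

/-- The radial push is jointly continuous away from `v = 0`. [folklore] -/
theorem continuousOn_radialPush :
    ContinuousOn (fun p : ℝ × E => radialPush p.1 p.2) {p | p.2 ≠ 0} := by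
  refine ContinuousOn.smul ?_ continuousOn_snd
  refine (continuousOn_const.sub continuousOn_fst).add (continuousOn_fst.mul ?_)
  exact (continuousOn_snd.norm).inv₀ fun p hp => (norm_pos_iff.2 hp).ne'

/-! ### The deformation of the punctured space -/

/-- A total inverse of the embedding `i` (junk `0` off its range). [folklore] -/
def embInv (hi : IsEmbedding i) (x : X) : E :=
  if hx : x ∈ range i then hi.toHomeomorph.symm ⟨x, hx⟩ else 0

omit [NormedSpace ℝ E] in
/-- `embInv ∘ i = id`. [folklore] -/
@[simp] theorem embInv_apply (hi : IsEmbedding i) (v : E) : embInv hi (i v) = v := by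
  rw [embInv, dif_pos (mem_range_self v)]
  exact hi.toHomeomorph_symm_apply v

omit [NormedSpace ℝ E] in
/-- `embInv` is continuous on the range of `i`. [folklore] -/
theorem continuousOn_embInv (hi : IsEmbedding i) : ContinuousOn (embInv hi) (range i) := by
  rw [continuousOn_iff_continuous_restrict]
  have h : (range i).restrict (embInv hi) = hi.toHomeomorph.symm := by
    funext ⟨x, hx⟩
    simp only [restrict_apply, embInv, dif_pos hx]
  rw [h]
  exact Homeomorph.continuous _

/-- **The radial deformation** `ρ_t : X → X`: `ρ_t (i v) = i (radialPush t v)` on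
`i (closed unit ball)`, the identity elsewhere. [folklore] -/
def deformFun (hi : IsEmbedding i) (t : I) (x : X) : X :=
  if x ∈ i '' closedBall (0 : E) 1 then i (radialPush t (embInv hi x)) else x

/-- `ρ_t (i v) = i (radialPush t v)` for `‖v‖ ≤ 1`. [folklore] -/
theorem deformFun_apply (hi : IsEmbedding i) (t : I) {v : E} (hv : ‖v‖ ≤ 1) :
    deformFun hi t (i v) = i (radialPush t v) := by
  rw [deformFun, if_pos ⟨v, mem_closedBall_zero_iff.2 hv, rfl⟩, embInv_apply]

/-- `ρ_t = id` off `i (closed unit ball)`. [folklore] -/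
theorem deformFun_of_not_mem_closedBall (hi : IsEmbedding i) (t : I) {x : X}
    (hx : x ∉ i '' closedBall (0 : E) 1) : deformFun hi t x = x := by
  rw [deformFun, if_neg hx]

/-- **`ρ_t` fixes `X ∖ i (B)` pointwise** (on `i (unit sphere)` both formulas give the identity).
[folklore] -/
theorem deformFun_of_not_mem (hi : IsEmbedding i) (t : I) {x : X}
    (hx : x ∉ i '' ball (0 : E) 1) : deformFun hi t x = x := by
  by_cases h : x ∈ i '' closedBall (0 : E) 1
  · obtain ⟨v, hv, rfl⟩ := h
    have hv1 : ‖v‖ = 1 := by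
      refine le_antisymm (mem_closedBall_zero_iff.1 hv) (not_lt.1 fun hlt => hx ?_)
      exact ⟨v, mem_ball_zero_iff.2 hlt, rfl⟩
    rw [deformFun_apply hi t hv1.le, radialPush_of_norm_eq_one _ hv1]
  · exact deformFun_of_not_mem_closedBall hi t h

/-- `ρ_0 = id`. [folklore] -/
theorem deformFun_zero (hi : IsEmbedding i) (x : X) : deformFun hi 0 x = x := by
  by_cases h : x ∈ i '' closedBall (0 : E) 1
  · obtain ⟨v, hv, rfl⟩ := h
    rw [deformFun_apply hi 0 (mem_closedBall_zero_iff.1 hv)]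
    simp
  · exact deformFun_of_not_mem_closedBall hi 0 h

/-- `ρ_t` does not hit the centre `i 0` on the punctured space. [folklore] -/
theorem deformFun_ne (hi : IsEmbedding i) (t : I) {x : X} (hx : x ≠ i 0) :
    deformFun hi t x ≠ i 0 := by
  by_cases h : x ∈ i '' closedBall (0 : E) 1
  · obtain ⟨v, hv, rfl⟩ := h
    have hv0 : v ≠ 0 := fun h0 => hx (by rw [h0])
    rw [deformFun_apply hi t (mem_closedBall_zero_iff.1 hv)]
    exact fun h' => radialPush_ne_zero (unitInterval.nonneg t) hv0
      (mem_closedBall_zero_iff.1 hv) (hi.injective h')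
  · rwa [deformFun_of_not_mem_closedBall hi t h]

/-- **`ρ_1` lands in `X ∖ i (B)`.** [folklore] -/
theorem deformFun_one_not_mem (hi : IsEmbedding i) {x : X} (hx : x ≠ i 0) :
    deformFun hi 1 x ∉ i '' ball (0 : E) 1 := by
  by_cases h : x ∈ i '' closedBall (0 : E) 1
  · obtain ⟨v, hv, rfl⟩ := h
    have hv0 : v ≠ 0 := fun h0 => hx (by rw [h0])
    rw [deformFun_apply hi 1 (mem_closedBall_zero_iff.1 hv)]
    rintro ⟨w, hw, hwv⟩
    have := hi.injective hwv
    rw [mem_ball_zero_iff, this, Set.Icc.coe_one, norm_radialPush_one hv0] at hw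
    exact lt_irrefl _ hw
  · rw [deformFun_of_not_mem_closedBall hi 1 h]
    exact fun h' => h (image_mono ball_subset_closedBall h')

section Continuity

variable [ProperSpace E] [T2Space X]

omit [NormedSpace ℝ E] in
/-- `i (closed unit ball)` is closed (compact image in a Hausdorff space). [folklore] -/
theorem isClosed_image_closedBall (hi : IsEmbedding i) : IsClosed (i '' closedBall (0 : E) 1) :=
  ((isCompact_closedBall (0 : E) 1).image hi.continuous).isClosed

/-- **`ρ` is jointly continuous on `[0,1] × (X ∖ {i 0})`** (as a map of the subtype): pasting the
closed pieces `X ∖ i (B)` (where `ρ` is the second projection; closed because `i (B)` is open)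
and `i (closed ball) ∖ {i 0}` (where `ρ = i ∘ radialPush ∘ (id × i⁻¹)`). [folklore] -/
theorem continuous_deformFun (hi : IsOpenEmbedding i) :
    Continuous fun z : I × ↥(({i 0}ᶜ : Set X)) => deformFun hi.isEmbedding z.1 (z.2 : X) := by
  set A : Set ↥(({i 0}ᶜ : Set X)) := Subtype.val ⁻¹' (i '' ball (0 : E) 1)ᶜ with hA
  set B : Set ↥(({i 0}ᶜ : Set X)) := Subtype.val ⁻¹' (i '' closedBall (0 : E) 1) with hB
  have hAc : IsClosed A :=
    (hi.isOpenMap _ isOpen_ball).isClosed_compl.preimage continuous_subtype_val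
  have hBc : IsClosed B :=
    (isClosed_image_closedBall hi.isEmbedding).preimage continuous_subtype_val
  have hcov : (univ : Set I) ×ˢ A ∪ (univ : Set I) ×ˢ B = univ := by
    rw [← prod_union, eq_univ_iff_forall]
    rintro ⟨t, x⟩
    refine ⟨mem_univ t, ?_⟩
    by_cases hx : (x : X) ∈ i '' closedBall (0 : E) 1
    · exact Or.inr hx
    · exact Or.inl fun h => hx (image_mono ball_subset_closedBall h)
  rw [← continuousOn_univ, ← hcov]
  refine ContinuousOn.union_of_isClosed ?_ ?_ (isClosed_univ.prod hAc) (isClosed_univ.prod hBc)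
  · -- on `X ∖ i (B)` the deformation is the identity
    refine (continuous_subtype_val.comp continuous_snd).continuousOn.congr fun z hz => ?_
    exact deformFun_of_not_mem hi.isEmbedding z.1 hz.2
  · -- on `i (closed ball) ∖ {i 0}`: `i ∘ radialPush ∘ (id × i⁻¹)`
    have heq : EqOn (fun z : I × ↥(({i 0}ᶜ : Set X)) => deformFun hi.isEmbedding z.1 (z.2 : X))
        (fun z => i (radialPush (z.1 : ℝ) (embInv hi.isEmbedding (z.2 : X))))
        ((univ : Set I) ×ˢ B) := fun z hz => if_pos hz.2
    refine ContinuousOn.congr ?_ heq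
    refine hi.continuous.comp_continuousOn ?_
    have hmaps : MapsTo (fun z : I × ↥(({i 0}ᶜ : Set X)) =>
        ((z.1 : ℝ), embInv hi.isEmbedding (z.2 : X))) ((univ : Set I) ×ˢ B)
        {p : ℝ × E | p.2 ≠ 0} := by
      rintro ⟨t, x⟩ ⟨-, v, hv, hvx⟩
      have hvx' : i v = (x : X) := hvx
      show embInv hi.isEmbedding (x : X) ≠ 0
      rw [← hvx', embInv_apply]
      rintro rfl
      exact x.2 hvx'.symm
    refine continuousOn_radialPush.comp ?_ hmaps
    refine (continuous_subtype_val.comp continuous_fst).continuousOn.prodMk ?_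
    refine (continuousOn_embInv hi.isEmbedding).comp
      (continuous_subtype_val.comp continuous_snd).continuousOn ?_
    rintro ⟨t, x⟩ ⟨-, hx⟩
    obtain ⟨v, -, hvx⟩ := hx
    exact ⟨v, hvx⟩

end Continuity

/-! ### The deformation retraction and the homotopy equivalence -/

omit [NormedSpace ℝ E] [TopologicalSpace X] in
/-- `i 0 ∈ i (B)`, so `X ∖ i (B) ⊆ X ∖ {i 0}`. [folklore] -/
theorem compl_image_ball_subset : (i '' ball (0 : E) 1)ᶜ ⊆ ({i 0}ᶜ : Set X) := by
  intro x hx h0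
  exact hx ⟨0, mem_ball_self one_pos, h0.symm⟩

/-- **The inclusion `X ∖ i (B) → X ∖ {i 0}`.** [folklore] -/
def incl : C(↥((i '' ball (0 : E) 1)ᶜ), ↥(({i 0}ᶜ : Set X))) :=
  ⟨Set.inclusion compl_image_ball_subset, continuous_inclusion _⟩

/-- **The deformation** `ρ : [0,1] × (X ∖ {i 0}) → X ∖ {i 0}`. [folklore] -/
def deform (hi : IsEmbedding i) (t : I) (x : ↥(({i 0}ᶜ : Set X))) : ↥(({i 0}ᶜ : Set X)) :=
  ⟨deformFun hi t x, deformFun_ne hi t x.2⟩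

/-- `ρ_0 = id`. [folklore] -/
@[simp] theorem deform_zero (hi : IsEmbedding i) (x : ↥(({i 0}ᶜ : Set X))) : deform hi 0 x = x :=
  Subtype.ext (deformFun_zero hi x)

/-- `ρ_t` is stationary on `X ∖ i (B)`. [folklore] -/
theorem deform_incl (hi : IsEmbedding i) (t : I) (x : ↥((i '' ball (0 : E) 1)ᶜ)) :
    deform hi t (incl x) = incl x :=
  Subtype.ext (deformFun_of_not_mem hi t x.2)

/-- **The retraction** `r : X ∖ {i 0} → X ∖ i (B)`, `r = ρ_1`. [folklore] -/
def retrFun (hi : IsEmbedding i) (x : ↥(({i 0}ᶜ : Set X))) : ↥((i '' ball (0 : E) 1)ᶜ) :=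
  ⟨deformFun hi 1 x, deformFun_one_not_mem hi x.2⟩

/-- `r ∘ incl = id`. [folklore] -/
@[simp] theorem retrFun_incl (hi : IsEmbedding i) (x : ↥((i '' ball (0 : E) 1)ᶜ)) :
    retrFun hi (incl x) = x :=
  Subtype.ext (deformFun_of_not_mem hi 1 x.2)

/-- `incl ∘ r = ρ_1`. [folklore] -/
theorem incl_retrFun (hi : IsEmbedding i) (x : ↥(({i 0}ᶜ : Set X))) :
    incl (retrFun hi x) = deform hi 1 x :=
  rfl

variable [ProperSpace E] [T2Space X]

/-- `ρ` is jointly continuous. [folklore] -/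
theorem continuous_deform (hi : IsOpenEmbedding i) :
    Continuous fun z : I × ↥(({i 0}ᶜ : Set X)) => deform hi.isEmbedding z.1 z.2 :=
  (continuous_deformFun hi).subtype_mk _

/-- The retraction is continuous. [folklore] -/
theorem continuous_retrFun (hi : IsOpenEmbedding i) : Continuous (retrFun hi.isEmbedding) :=
  ((continuous_deformFun hi).comp (continuous_const.prodMk continuous_id)).subtype_mk _

/-- **The retraction `r : X ∖ {i 0} → X ∖ i (B)`** as a continuous map. [folklore] -/
def retr (hi : IsOpenEmbedding i) : C(↥(({i 0}ᶜ : Set X)), ↥((i '' ball (0 : E) 1)ᶜ)) :=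
  ⟨retrFun hi.isEmbedding, continuous_retrFun hi⟩

/-- `r ∘ incl = id`: `X ∖ i (B)` is a retract of `X ∖ {i 0}`. [folklore] -/
theorem retr_comp_incl (hi : IsOpenEmbedding i) : (retr hi).comp incl = ContinuousMap.id _ := by
  ext x
  exact congrArg Subtype.val (retrFun_incl hi.isEmbedding x)

/-- **The homotopy `id ≃ incl ∘ r` rel `X ∖ i (B)`** given by `ρ` (a strong deformation
retraction of `X ∖ {i 0}` onto `X ∖ i (B)`). [folklore] -/
def deformHomotopy (hi : IsOpenEmbedding i) :
    ContinuousMap.HomotopyRel (ContinuousMap.id _) (incl.comp (retr hi))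
      (range (incl : ↥((i '' ball (0 : E) 1)ᶜ) → ↥(({i 0}ᶜ : Set X)))) where
  toFun z := deform hi.isEmbedding z.1 z.2
  continuous_toFun := continuous_deform hi
  map_zero_left x := deform_zero hi.isEmbedding x
  map_one_left x := rfl
  prop' t x hx := by
    obtain ⟨y, rfl⟩ := hx
    show deform hi.isEmbedding t (incl y) = incl y
    exact deform_incl hi.isEmbedding t y

/-- **Theorem (the disc complement is a deformation retract of the punctured space).** For an
open embedding `i : E → X` of a proper real normed space into a Hausdorff space, the inclusion
`X ∖ i (B) → X ∖ {i 0}` (`B` the open unit ball) is a homotopy equivalence, with homotopy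
inverse the radial retraction (Hatcher, *Algebraic Topology* (2002), Ch. 0 p. 2; proof of
Thm. 2.26: `ℝᵐ - {x}` deformation retracts onto `Sᵐ⁻¹`). [cite: HatcherAT2002, Ch. 0 p. 2 (deformation retractions) and proof of Thm. 2.26] -/
def homotopyEquiv (hi : IsOpenEmbedding i) :
    ↥((i '' ball (0 : E) 1)ᶜ) ≃ₕ ↥(({i 0}ᶜ : Set X)) where
  toFun := incl
  invFun := retr hi
  left_inv := by rw [retr_comp_incl hi]
  right_inv := ⟨(deformHomotopy hi).toHomotopy.symm⟩

/-- Unfolding: the homotopy equivalence is the inclusion. [folklore] -/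
@[simp] theorem homotopyEquiv_apply (hi : IsOpenEmbedding i) (x : ↥((i '' ball (0 : E) 1)ᶜ)) :
    (homotopyEquiv hi x : X) = x := rfl

end BallComplement

end Literature.AlgebraicTopology.Homotopy
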